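import Literature.Topology.FourManifolds.LefschetzBaseModelIdentification
import Literature.Topology.FourManifolds.DiffeomorphJacobianSign
import HarnessLib

/-!
# The page-preserving identification of the Lefschetz base with its model preserves orientation

Topic `Literature/Topology/FourManifolds`; a proofs-only companion (no definitions, no named
facts) of `LefschetzBaseModelIdentification.lean`.  The identification
`Φ = Φ₂ ∘ Φ₁ : {rho g ≤ 1/4} → {modelFun g ε q ≤ 1/4}` is assembled from two time-one maps of
flows: stage 1 (`exists_diffeomorph_profileChange`) is the identity on the open set
`{‖x‖² < 17/4} ∋ 0`, stage 2 (`exists_diffeomorph_rounding_with_far`) is the identity on the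
open set `{rho g > 3/8} ∋ 0` (`rho g 0 = 1`).  By `Diffeomorph.det_fderiv_pos_of_eqOn`
(`DiffeomorphJacobianSign.lean`) both have everywhere positive Jacobian determinant, hence so
has `Φ` (`Diffeomorph.det_fderiv_trans_pos`):

* `exists_model_identification_orient` — `exists_model_identification` with the extra clause
  `∀ z, 0 < det DΦ(z)`;
* `exists_model_diffeomorph_orient` — the same at the level of the manifolds with boundary.

Use: the orientation clause (`IsPosBdryFrame` ↦ complex orientation) of
`palf_stein_supportedByBoundaryOpenBook_of_reebModels` for the base-case model
(`LefschetzBaseModelStein.lean`): `d(incl ∘ e) = DΦ ∘ d(incl)` with `det DΦ > 0`.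

## References

* J. Milnor, *Topology from the Differentiable Viewpoint* (1965), §6. [MilnorTDV1965]
* J. Milnor, *Morse theory* (1963), Thm. 3.1. [Milnor1963]
-/

noncomputable section

open scoped Manifold ContDiff Topology
open Set Function Metric Filter

namespace Literature.Topology.FourManifolds

namespace LefschetzBase

/-- **The page-preserving identification is orientation preserving.**  For every smooth `q ≥ 0`
there is `ε₀ > 0` such that for all `ε ∈ [0, ε₀]`: `1/4` is a regular value of
`Ψ = modelFun g ε q`, and some diffeomorphism `Φ` of `ℂ²` carries `{rho g ≤ 1/4}` onto
`{Ψ ≤ 1/4}`, `{rho g = 1/4}` onto `{Ψ = 1/4}`, satisfies `w(Φ z) = r w(z)` with `r > 0`, and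
has `det DΦ(z) > 0` for every `z`. [folklore] -/
theorem exists_model_identification_orient (g : ℕ) {q : EuclideanSpace ℝ (Fin 4) → ℝ}
    (hq : ContDiff ℝ ∞ q) (hq0 : ∀ z, 0 ≤ q z) :
    ∃ ε₀ : ℝ, 0 < ε₀ ∧ ∀ ε : ℝ, 0 ≤ ε → ε ≤ ε₀ →
      IsRegularLevel (𝓡 4) (modelFun g ε q) (1 / 4) ∧
      ∃ Φ : EuclideanSpace ℝ (Fin 4) ≃ₘ⟮𝓘(ℝ, EuclideanSpace ℝ (Fin 4)),
          𝓘(ℝ, EuclideanSpace ℝ (Fin 4))⟯ EuclideanSpace ℝ (Fin 4),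
        Φ '' (rho g ⁻¹' Iic (1 / 4)) = modelFun g ε q ⁻¹' Iic (1 / 4) ∧
          Φ '' (rho g ⁻¹' {1 / 4}) = modelFun g ε q ⁻¹' {1 / 4} ∧
          (∀ z, ∃ r : ℝ, 0 < r ∧ w g (Φ z) = (r : ℂ) * w g z) ∧
          ∀ z, 0 < LinearMap.det (fderiv ℝ Φ z :
            EuclideanSpace ℝ (Fin 4) →ₗ[ℝ] EuclideanSpace ℝ (Fin 4)) := by
  -- stage 1
  obtain ⟨Φ₁, h1le, h1eq, h1w, h1fix⟩ := exists_diffeomorph_profileChange g contDiff_convexProfile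
    (s₀ := 17 / 4) (by norm_num) (fun s hs => convexProfile_of_le hs) eta_le_convexProfile
    (fun s hs => deriv_convexProfile_pos (by linarith))
  have hdet₁ : ∀ z, 0 < LinearMap.det (fderiv ℝ Φ₁ z :
      EuclideanSpace ℝ (Fin 4) →ₗ[ℝ] EuclideanSpace ℝ (Fin 4)) :=
    Diffeomorph.det_fderiv_pos_of_eqOn Φ₁
      (U := {p : EuclideanSpace ℝ (Fin 4) | ‖cx p‖ ^ 2 < 17 / 4})
      (isOpen_lt ((continuous_norm.comp contDiff_cx.continuous).pow 2) continuous_const)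
      (x₀ := 0) (by simp) (fun y hy => h1fix y hy)
  -- stage 2
  obtain ⟨ε₀, hε₀, H⟩ := exists_diffeomorph_rounding_with_far g contDiff_convexProfile
    (fun s hs => convexProfile_of_le_four hs) eta_le_convexProfile deriv_convexProfile_nonneg
    (s₁ := 17 / 4) convexProfile_seventeen_quarters_le
    (fun s hs => deriv_convexProfile_pos (by linarith)) hq hq0
  refine ⟨ε₀, hε₀, fun ε hε hεε₀ => ?_⟩
  obtain ⟨hreg, Φ₂, h2le, h2eq, h2w, h2fix⟩ := H ε hε hεε₀
  have hdet₂ : ∀ z, 0 < LinearMap.det (fderiv ℝ Φ₂ z :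
      EuclideanSpace ℝ (Fin 4) →ₗ[ℝ] EuclideanSpace ℝ (Fin 4)) :=
    Diffeomorph.det_fderiv_pos_of_eqOn Φ₂
      (U := {p : EuclideanSpace ℝ (Fin 4) | 3 / 8 < rho g p})
      (isOpen_lt continuous_const (contDiff_rho g).continuous)
      (x₀ := 0) (by simp [rho_zero]; norm_num) (fun y hy => h2fix y hy)
  refine ⟨hreg, Φ₁.trans Φ₂, ?_, ?_, fun z => ?_, Diffeomorph.det_fderiv_trans_pos hdet₁ hdet₂⟩
  · have : ((Φ₁.trans Φ₂) : EuclideanSpace ℝ (Fin 4) → EuclideanSpace ℝ (Fin 4)) = Φ₂ ∘ Φ₁ := rfl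
    rw [this, image_comp, h1le, h2le]
    rfl
  · have : ((Φ₁.trans Φ₂) : EuclideanSpace ℝ (Fin 4) → EuclideanSpace ℝ (Fin 4)) = Φ₂ ∘ Φ₁ := rfl
    rw [this, image_comp, h1eq, h2eq]
    rfl
  · obtain ⟨r, hr, hrz⟩ := h2w (Φ₁ z)
    refine ⟨r, hr, ?_⟩
    show w g (Φ₂ (Φ₁ z)) = _
    rw [hrz, h1w]

/-- **The base is diffeomorphic to the model over an orientation-preserving, page-preserving
diffeomorphism of `ℂ²`.** [folklore] -/
theorem exists_model_diffeomorph_orient (g : ℕ) {q : EuclideanSpace ℝ (Fin 4) → ℝ}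
    (hq : ContDiff ℝ ∞ q) (hq0 : ∀ z, 0 ≤ q z) :
    ∃ ε₀ : ℝ, 0 < ε₀ ∧ ∀ ε : ℝ, 0 ≤ ε → ε ≤ ε₀ →
      ∃ (hΨ : IsRegularLevel (𝓡 4) (modelFun g ε q) (1 / 4))
        (Φ : EuclideanSpace ℝ (Fin 4) ≃ₘ⟮𝓘(ℝ, EuclideanSpace ℝ (Fin 4)),
          𝓘(ℝ, EuclideanSpace ℝ (Fin 4))⟯ EuclideanSpace ℝ (Fin 4))
        (e : Base g ≃ₘ⟮𝓡∂ 4, 𝓡∂ 4⟯ RegularSublevel hΨ),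
        (∀ p, RegularSublevel.incl hΨ (e p) = Φ (RegularSublevel.incl (isRegularLevel_rho g) p)) ∧
          Φ '' (rho g ⁻¹' Iic (1 / 4)) = modelFun g ε q ⁻¹' Iic (1 / 4) ∧
          Φ '' (rho g ⁻¹' {1 / 4}) = modelFun g ε q ⁻¹' {1 / 4} ∧
          (∀ z, ∃ r : ℝ, 0 < r ∧ w g (Φ z) = (r : ℂ) * w g z) ∧
          ∀ z, 0 < LinearMap.det (fderiv ℝ Φ z :
            EuclideanSpace ℝ (Fin 4) →ₗ[ℝ] EuclideanSpace ℝ (Fin 4)) := by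
  obtain ⟨ε₀, hε₀, H⟩ := exists_model_identification_orient g hq hq0
  refine ⟨ε₀, hε₀, fun ε hε hεε₀ => ?_⟩
  obtain ⟨hΨ, Φ, hle, heq, hw, hdet⟩ := H ε hε hεε₀
  exact ⟨hΨ, Φ, RegularSublevel.diffeomorphOfImageEq (isRegularLevel_rho g) hΨ Φ hle,
    fun p => rfl, hle, heq, hw, hdet⟩

end LefschetzBase

end Literature.Topology.FourManifolds

end
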